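import Summits.BirchSwinnertonDyer.BirchSwinnertonDyer.Theorems.SignedBaseChangeAnticyclotomicEisensteinDivisibilityAdmdefRootDichotomy
import HarnessLib

/-!
# Line `admdef` v18/v19: the SELMER-RANK SPLIT of the non-primitive locus and the EXISTENTIAL anchor — on the core root
# (`dim_𝔽p Sel_p(E/K)[p] = 1`) the research piece is asked in its true currency, EMPTINESS (text (RV₁)); off the core root (`dim ≥ 3`) the
# composition needs Brandt data with a unit weighted period at SOME odd admissible level (text (Anch∃)_NP,≥3), not at every Selmer-zero vertex
# (crux `AnticyclotomicEisensteinDivisibility`, stmt-BirchSwinnertonDyer-20727; LEAD seat bsd-line-sbc-p1 gen 22, `--supports stmt-BirchSwinnertonDyer-20727`)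

WHY THIS FILE.  Skeleton v16/v17 (LEAD gen 21, `Theorems/…AdmdefRootDichotomy`) asks the line's research stub (Anch±)_NP — Brandt data with a
non-zero mod-`p` WEIGHTED toric period at EVERY odd zero vertex carrying both Bertolini–Darmon signs — only on the NON-PRIMITIVE locus (NP):
«some pinned `+` tuple (embedding datum, non-split datum at `𝔭`, Castella–Wan BDP frame, transfer class `z` with `TransferInputs`, `+` signed
bipartite system `B` with limit base class `z`) has bottom class `z_{0,1}` invisible at every admissible Frobenius».  Two observations reshape it.
(1) The ideator reading bsd-idea-5 g32 (`Cruxes/…/Lines/admdef-npcore-g32.md` (R1)–(R3)) splits (NP) by the ODD number `d := dim_𝔽p Sel_p(E/K)[p]`: at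
`k = 1` the root of Howard's bipartite graph is CORE exactly when `d = 1`, and then length-one rigidity (Burungale–Castella–Kim 2021 Lem. 7.3 ∕ Prop. 7.4:
a mod-`℘` bipartite section non-zero at one vertex generates the stub module at every core vertex) turns (NP) into `B ≡ 0 (mod ℘)` — NO vertex carries
a unit `λ`, and (BRIDGE (b)) no reachable Selmer-zero definite vertex a unit weighted period: on (NP) ∩ {`d = 1`} the v16/v17 anchor text can hold only
VACUOUSLY («empty or false»).  (2) The composition consumes the anchor only through the root dichotomy's `hwalk` input — SOME odd Zhang-admissible level
with Brandt data of non-zero weighted period (which (b) turns into Howard's existential `HasUnitLambda`) — so the vertex-wise «EVERY odd zero vertex with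
both signs» form (where print delivers it) is more than needed.  THIS FILE wires both into the composition (pure logic over landed kernel pieces):

* `bipartiteNV_text_of_bridge_of_rankSplit` — the line's [NV]♯ text (frame, transfer class, `+` system at it, `HasUnitLambda`) FROM: the v14/v15 BRIDGE
  text (cite conjuncts (15)–(16)), Cassels–Tate + Dokchitser–Dokchitser ((Par): `d` is odd, `…AdmdefOddSelmerDim`), and TWO research texts replacing
  (Anch±)_NP: (RV₁) «on cell β, `d = 1` ⟹ ¬(NP)» — the core-root piece stated as EMPTINESS (Zhang–Kolyvagin `p`-indivisibility of the pinned `+`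
  bottom class at good supersingular `p` on the non-square-free all-ramified cell; the supersingular, cell-β twin of AKR's
  `Theses.AdditiveKolyvaginRoad.BottomRankOneAdditive`; implied by `BSD_p(E/K)` since on β every Tamagawa number and the Manin constant are `p`-units) —
  and (Anch∃)_NP,≥3 «on cell β ∩ (NP) with `3 ≤ d`, SOME odd Zhang-admissible level carries Brandt data with non-zero weighted period» (by the same rigidity
  = mod-`℘` primitivity of the signed system; fed in print only by the rank-0 anchor (F1) = Wan16 Thm. 1.4 ×2 ∘ η at a Selmer-zero both-signs vertex).
  Proof: the ROOT DICHOTOMY (`…AdmdefRootDichotomy.hasUnitLambda_of_rootDichotomy`); in the non-primitive branch the tuple witnesses (NP); case on the parity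
  witness of `d` ((Par) + the AKR identity `dim Sel_p(E/K)[p] = dim Sel_∅⁺ + dim Sel_∅⁻`): `d = 1` is absurd by (RV₁); `d ≥ 3` hands `hwalk` to (Anch∃)_NP,≥3.
* `anchorExists3_of_anchorNP3` — conservativity: v18's vertex-wise text (Anch±)_NP,≥3 ((Anch±)_NP with the inserted hypothesis `3 ≤ d`) implies
  (Anch∃)_NP,≥3, by W. Zhang's walk + the signed detour (`…OfStubsAdmdefV14.exists_admissibleOddLevel_of_anchorSigned_of_split`) fed by (Par) and complex
  conjugation; one way only in kernel (the converse is the rigidity reading).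
* (sibling file `Theorems/…AdmdefRankSplitRecovery.lean`: (Anch±)_NP ⟹ (Anch±)_NP,≥3 and the RECOVERY (RV₁) ∧ (Anch±)_NP,≥3 ⟹ (Anch±)_NP modulo parity —
  the rank split ALONE loses nothing; the existential weakening is deliberate; sibling census `Theorems/…OfStubsAdmdefV19.lean`: the crux BY NAME from the
  five v19 stub texts.)

HONEST FRAMING: kernel glue over typed predicates and cited facts taken as hypotheses (CONDITIONAL, audit `proof.conditional`); (RV₁) and (Anch∃)_NP,≥3
remain RESEARCH (no print on cell β ∖ α at supersingular `p`); the rigidity reading (R1)/(R3) itself is NOT typed here; no Brandt module is computed;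
BSD / the crux / [NV] are NOT proved by this file.

References: [cite: BurungaleCastellaKim2021, arXiv:1908.09512 Lem. 7.3, Prop. 7.4, Lem. 7.6] [cite: CastellaEtAl2025, Thm. 7.4 (second law), (7.2), Thm. 7.5, §7.4 (arXiv:2308.10474v2 pp. 30–33)]
[cite: Howard2006, Cor. 2.4.9, Thm. 3.2.3 (c)] [cite: WZhang2014, Thm. 1.1, Thm. 9.1 (proof), Lemma 7.3, §5 (5.1)] [cite: CastellaWan2023, Thm. A (arXiv:1607.02019v3)]
[cite: DokchitserDokchitserAnnals2010, §4.6] [cite: GrossLMS1991, §2 (2.2)–(2.3)].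
-/

-- D-0017: single-problem summit, the namespace repeats the problem name by design.
set_option linter.dupNamespace false
set_option autoImplicit false

noncomputable section

open scoped Classical NumberField

open NumberField IsDedekindDomain Field
  Literature.NumberTheory.EllipticCurves Literature.NumberTheory.EllipticCurves.ModularForms
  Literature.NumberTheory.EllipticCurves.Rank1Residual Literature.NumberTheory.EllipticCurves.Castella2018
  Literature.NumberTheory.EllipticCurves.CastellaWan2024 Literature.NumberTheory.GaloisRepresentations
  Literature.NumberTheory.EllipticCurves.YanZhu2026 Literature.NumberTheory.Automorphic
  Summit.BirchSwinnertonDyer.Rank1Residual.X11b Summit.BirchSwinnertonDyer.Rank1Residual.X11b.Halves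
  Summit.BirchSwinnertonDyer.BirchSwinnertonDyer.Theorems
open Literature.NumberTheory.EllipticCurves.AcSigned Literature.NumberTheory.EllipticCurves.CastellaHsuKunduLeeLiu2025
  Literature.NumberTheory.EllipticCurves.BertoliniDarmon2005 Literature.NumberTheory.EllipticCurves.IwasawaDual
open WeierstrassCurve (geomTorsion)

namespace Summit.BirchSwinnertonDyer.BirchSwinnertonDyer.Theorems.SignedBaseChangeAcDivAdmdefRankSplit

open Summit.BirchSwinnertonDyer.BirchSwinnertonDyer.Theses.SignedBaseChange
open Summit.BirchSwinnertonDyer.BirchSwinnertonDyer.Theorems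

/-! ## §1 [NV]♯ from the BRIDGE text, the two parity facts, (RV₁) and (Anch∃)_NP,≥3 — the rank split wired through the root dichotomy -/

/-- **The line's [NV]♯ text (cell line dropped) FROM: the v14/v15 BRIDGE text, Cassels–Tate + Dokchitser–Dokchitser ((Par) via `…AdmdefOddSelmerDim`),
and the two v19 research texts (RV₁) («on cell β, `dim_𝔽p Sel_p(E/K)[p] = 1` ⟹ no pinned `+` tuple dies at the root») and (Anch∃)_NP,≥3 («on cell β ∩ (NP)
with `3 ≤ dim_𝔽p Sel_p(E/K)[p]`, SOME odd Zhang-admissible level carries Brandt data with non-zero weighted period»).**  Proof: for the given non-split datum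
take the BRIDGE's tuple; `hasUnitLambda_of_rootDichotomy` with `P` = «Brandt data with non-zero weighted period at level `(N, m)`»; in the non-primitive
branch the tuple itself witnesses (NP); case on the parity witness `k` of `d = 2k + 1` ((Par) + `AdditiveKoly.finrank_selmer_eq_finrank_selQP_add`): `k = 0`
is absurd by (RV₁), `k ≥ 1` gives `3 ≤ d` and (Anch∃)_NP,≥3 is the walk hypothesis itself.  CONDITIONAL on the displayed texts; nothing about (RV₁) or
(Anch∃)_NP,≥3 is proved. [cite: BurungaleCastellaKim2021, arXiv:1908.09512 Lem. 7.3, Prop. 7.4] [cite: CastellaEtAl2025, Thm. 7.4, (7.2), Thm. 7.5, §7.4 (arXiv:2308.10474v2 pp. 30–33)]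
[cite: WZhang2014, §5 (5.1), Thm. 9.2] [cite: Howard2006, Thm. 3.2.3 (c)] [cite: DokchitserDokchitserAnnals2010, §4.6] -/
theorem bipartiteNV_text_of_bridge_of_rankSplit
    (hCT : ∀ (K : Type) [Field K] [NumberField K], WeierstrassCurve.exists_casselsTate_pairing (K := K))
    (hDD : Literature.NumberTheory.EllipticCurves.dokchitser_selmerCorank_baseChange_mod_two_eq)
    (hBr : ∀ {p : ℕ} [Fact p.Prime] (ι : PadicAlgCl p ≃+* ℂ) (W : WeierstrassCurve ℚ) [W.IsElliptic]
      [W.IsGloballyMinimal] (K : Type) [Field K] [NumberField K]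
      (𝔭 𝔭bar : HeightOneSpectrum (𝓞 K)) (κ : ZpExtension K p) (γ : absoluteGaloisGroup K)
      [hγF : Fact (κ.IsTopGenerator γ)] {N : ℕ} [NeZero N] {f : CuspForm (CongruenceSubgroup.Gamma0 N) 2}
      (_ : IsNewformOf W f),
      (N : ℤ) = W.conductorNorm ℤ → 5 ≤ p → W.HasGoodReductionAtPrime p → W.frobeniusTrace p = 0 →
      Surj W p →
      IsImaginaryQuadratic K → ((Ideal.span {(p : ℤ)}).primesOver (𝓞 K)).ncard = 2 →
        (h𝔭 : ((p : ℕ) : 𝓞 K) ∈ 𝔭.asIdeal) →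
        (∀ (w : InfinitePlace K) (k : 𝓞 K), k ∈ 𝔭.asIdeal ↔ ‖ι.symm (w.embedding (k : K))‖ < 1) →
        ((p : ℕ) : 𝓞 K) ∈ 𝔭bar.asIdeal → (hne : 𝔭bar ≠ 𝔭) →
      (∀ ℓ : ℕ, ℓ.Prime → ℓ ∣ N → ((Ideal.span {(ℓ : ℤ)}).primesOver (𝓞 K)).ncard = 2) →
      IsCoprime (N : ℤ) (NumberField.discr K) → ¬ p ∣ NumberField.classNumber K →
      ¬ Squarefree N →
      (∀ q : ℕ, q.Prime → q ∣ N →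
        ∃ v : HeightOneSpectrum (𝓞 ℚ), ((q : ℕ) : 𝓞 ℚ) ∈ v.asIdeal ∧
          ∃ 𝔓 ∈ v.primesAbove, ∃ σ ∈ 𝔓.inertia (absoluteGaloisGroup ℚ),
            ∃ P : W.geomTorsion (p : ℤ), σ • P ≠ P) →
      κ.IsAnticyclotomic →
      ∀ (h𝔭ns : AcSigned.IsNonsplitIn κ 𝔭) (γ𝔭 : absoluteGaloisGroup (𝔭.adicCompletion K))
        (hγ𝔭 : κ (resGalOfEmb (closureEmb (K := K) (𝔭.adicCompletion K)) γ𝔭) = κ γ),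
        ∃ (ΩK : ℂ) (Ωp : (unrIntegers p)ˣ) (L : UnrSeries p), ΩK ≠ 0 ∧
          IsCWBDPLFunction ι 𝔭 κ γ f (NumberField.discr K) ΩK ((Ωp : unrIntegers p) : ℂ_[p]) L ∧
          ∃ (z : AcSigned.selmerLambdaAdic (W.baseChange K) p κ γ (fun _ ↦ .sgn 1))
            (B : CastellaHsuKunduLeeLiu2025.SignedBipartiteSystem W K p κ),
            AcSigned.TransferInputs (W.baseChange K) p κ γ hγF.out 𝔭 h𝔭ns γ𝔭 hγ𝔭 𝔭bar (fun h ↦ hne h.symm) h𝔭 1 z L ∧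
            CastellaHsuKunduLeeLiu2025.IsSignedBipartiteSystem W K p κ γ N 1 B ∧ B.IsLimitBaseClass z.1 ∧
            ∀ s : Finset ℕ, IsZhangAdmissibleLevel N K (fun ℓ ↦ W.frobeniusTrace ℓ) p s → Odd s.card →
              (∃ (S : Brandt.XiSetup N (∏ q ∈ s, q)) (ψ : K →ₐ[ℚ] S.D) (I : Submodule ℤ S.D)
                  (φ : Brandt.ClassSet S.O → ZMod p),
                  Brandt.IsGrossPoint S.O ψ I ∧
                  (letI : Fintype (Brandt.ClassSet S.O) := Fintype.ofFinite _
                   φ ∈ Brandt.eigenSpace (ZMod p) (N * ∏ q ∈ s, q) (Brandt.matrix S.O) (fun ℓ ↦ W.frobeniusTrace ℓ)) ∧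
                  Brandt.toricPeriod S.O ψ I (fun i ↦ (Brandt.weight S.O i : ZMod p) * φ i) ≠ 0) →
              IsUnit (PowerSeries.constantCoeff (B.lam 1 (∏ q ∈ s, q))))
    (hRV :
    ∀ {p : ℕ} [Fact p.Prime] (W : WeierstrassCurve ℚ) [W.IsElliptic] [W.IsGloballyMinimal]
      (K : Type) [Field K] [NumberField K] {N : ℕ} [NeZero N] {f : CuspForm (CongruenceSubgroup.Gamma0 N) 2}
      (_ : IsNewformOf W f),
      (N : ℤ) = W.conductorNorm ℤ → 5 ≤ p → W.HasGoodReductionAtPrime p → W.frobeniusTrace p = 0 →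
      Surj W p →
      IsImaginaryQuadratic K → ((Ideal.span {(p : ℤ)}).primesOver (𝓞 K)).ncard = 2 →
      (∀ ℓ : ℕ, ℓ.Prime → ℓ ∣ N → ((Ideal.span {(ℓ : ℤ)}).primesOver (𝓞 K)).ncard = 2) →
      IsCoprime (N : ℤ) (NumberField.discr K) → ¬ p ∣ NumberField.classNumber K →
      ¬ Squarefree N →
      (∀ q : ℕ, q.Prime → q ∣ N →
        ∃ v : HeightOneSpectrum (𝓞 ℚ), ((q : ℕ) : 𝓞 ℚ) ∈ v.asIdeal ∧
          ∃ 𝔓 ∈ v.primesAbove, ∃ σ ∈ 𝔓.inertia (absoluteGaloisGroup ℚ),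
            ∃ P : W.geomTorsion (p : ℤ), σ • P ≠ P) →
      ∀ [Module (ZMod p) (AdditiveKoly.Vp W K p)],
        Module.finrank (ZMod p)
          (AddSubgroup.toZModSubmodule p (WeierstrassCurve.selmerGroup (W.baseChange K) ((p ^ 1 : ℕ) : ℤ))) = 1 →
      ¬ (∃ (ι : PadicAlgCl p ≃+* ℂ) (𝔭 𝔭bar : HeightOneSpectrum (𝓞 K)) (κ : ZpExtension K p) (γ : absoluteGaloisGroup K)
          (hγ : κ.IsTopGenerator γ) (h𝔭 : ((p : ℕ) : 𝓞 K) ∈ 𝔭.asIdeal) (hne : 𝔭bar ≠ 𝔭)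
          (h𝔭ns : AcSigned.IsNonsplitIn κ 𝔭) (γ𝔭 : absoluteGaloisGroup (𝔭.adicCompletion K))
          (hγ𝔭 : κ (resGalOfEmb (closureEmb (K := K) (𝔭.adicCompletion K)) γ𝔭) = κ γ)
          (ΩK : ℂ) (Ωp : (unrIntegers p)ˣ) (L : UnrSeries p)
          (z : AcSigned.selmerLambdaAdic (W.baseChange K) p κ γ (fun _ ↦ .sgn 1))
          (B : CastellaHsuKunduLeeLiu2025.SignedBipartiteSystem W K p κ),
          κ.IsAnticyclotomic ∧ (∀ (w : InfinitePlace K) (k : 𝓞 K), k ∈ 𝔭.asIdeal ↔ ‖ι.symm (w.embedding (k : K))‖ < 1) ∧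
          ((p : ℕ) : 𝓞 K) ∈ 𝔭bar.asIdeal ∧ ΩK ≠ 0 ∧
          IsCWBDPLFunction ι 𝔭 κ γ f (NumberField.discr K) ΩK ((Ωp : unrIntegers p) : ℂ_[p]) L ∧
          AcSigned.TransferInputs (W.baseChange K) p κ γ hγ 𝔭 h𝔭ns γ𝔭 hγ𝔭 𝔭bar (fun h ↦ hne h.symm) h𝔭 1 z L ∧
          CastellaHsuKunduLeeLiu2025.IsSignedBipartiteSystem W K p κ γ N 1 B ∧ B.IsLimitBaseClass z.1 ∧
          ∀ (q : ℕ), IsAdmissiblePrime N K (fun ℓ ↦ W.frobeniusTrace ℓ) p 1 q →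
            ∀ (v : HeightOneSpectrum (𝓞 K)), ((q : ℕ) : 𝓞 K) ∈ v.asIdeal →
            ∀ 𝔓 ∈ v.primesAbove, ∀ (φ : absoluteGaloisGroup K) (hφ : φ ∈ κ.kerSubgroup),
              φ ∈ 𝔓.decompositionSubgroup (absoluteGaloisGroup K) → IsArithFrobAt (𝓞 K) φ 𝔓 →
              resOfLe (geomTorsion (W.baseChange K) ((p : ℤ) ^ 1))
                ((Subgroup.zpowers_le.mpr hφ).trans (κ.kerSubgroup_le_layerSubgroup 0)) (z.1 0 1) = 0))
    (hAnchE :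
    ∀ {p : ℕ} [Fact p.Prime] (W : WeierstrassCurve ℚ) [W.IsElliptic] [W.IsGloballyMinimal]
      (K : Type) [Field K] [NumberField K] {N : ℕ} [NeZero N] {f : CuspForm (CongruenceSubgroup.Gamma0 N) 2}
      (_ : IsNewformOf W f),
      (N : ℤ) = W.conductorNorm ℤ → 5 ≤ p → W.HasGoodReductionAtPrime p → W.frobeniusTrace p = 0 →
      Surj W p →
      IsImaginaryQuadratic K → ((Ideal.span {(p : ℤ)}).primesOver (𝓞 K)).ncard = 2 →
      (∀ ℓ : ℕ, ℓ.Prime → ℓ ∣ N → ((Ideal.span {(ℓ : ℤ)}).primesOver (𝓞 K)).ncard = 2) →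
      IsCoprime (N : ℤ) (NumberField.discr K) → ¬ p ∣ NumberField.classNumber K →
      ¬ Squarefree N →
      (∀ q : ℕ, q.Prime → q ∣ N →
        ∃ v : HeightOneSpectrum (𝓞 ℚ), ((q : ℕ) : 𝓞 ℚ) ∈ v.asIdeal ∧
          ∃ 𝔓 ∈ v.primesAbove, ∃ σ ∈ 𝔓.inertia (absoluteGaloisGroup ℚ),
            ∃ P : W.geomTorsion (p : ℤ), σ • P ≠ P) →
      -- (NP): some PINNED `+` tuple whose bottom class is invisible at every admissible Frobenius
      (∃ (ι : PadicAlgCl p ≃+* ℂ) (𝔭 𝔭bar : HeightOneSpectrum (𝓞 K)) (κ : ZpExtension K p) (γ : absoluteGaloisGroup K)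
          (hγ : κ.IsTopGenerator γ) (h𝔭 : ((p : ℕ) : 𝓞 K) ∈ 𝔭.asIdeal) (hne : 𝔭bar ≠ 𝔭)
          (h𝔭ns : AcSigned.IsNonsplitIn κ 𝔭) (γ𝔭 : absoluteGaloisGroup (𝔭.adicCompletion K))
          (hγ𝔭 : κ (resGalOfEmb (closureEmb (K := K) (𝔭.adicCompletion K)) γ𝔭) = κ γ)
          (ΩK : ℂ) (Ωp : (unrIntegers p)ˣ) (L : UnrSeries p)
          (z : AcSigned.selmerLambdaAdic (W.baseChange K) p κ γ (fun _ ↦ .sgn 1))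
          (B : CastellaHsuKunduLeeLiu2025.SignedBipartiteSystem W K p κ),
          κ.IsAnticyclotomic ∧ (∀ (w : InfinitePlace K) (k : 𝓞 K), k ∈ 𝔭.asIdeal ↔ ‖ι.symm (w.embedding (k : K))‖ < 1) ∧
          ((p : ℕ) : 𝓞 K) ∈ 𝔭bar.asIdeal ∧ ΩK ≠ 0 ∧
          IsCWBDPLFunction ι 𝔭 κ γ f (NumberField.discr K) ΩK ((Ωp : unrIntegers p) : ℂ_[p]) L ∧
          AcSigned.TransferInputs (W.baseChange K) p κ γ hγ 𝔭 h𝔭ns γ𝔭 hγ𝔭 𝔭bar (fun h ↦ hne h.symm) h𝔭 1 z L ∧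
          CastellaHsuKunduLeeLiu2025.IsSignedBipartiteSystem W K p κ γ N 1 B ∧ B.IsLimitBaseClass z.1 ∧
          ∀ (q : ℕ), IsAdmissiblePrime N K (fun ℓ ↦ W.frobeniusTrace ℓ) p 1 q →
            ∀ (v : HeightOneSpectrum (𝓞 K)), ((q : ℕ) : 𝓞 K) ∈ v.asIdeal →
            ∀ 𝔓 ∈ v.primesAbove, ∀ (φ : absoluteGaloisGroup K) (hφ : φ ∈ κ.kerSubgroup),
              φ ∈ 𝔓.decompositionSubgroup (absoluteGaloisGroup K) → IsArithFrobAt (𝓞 K) φ 𝔓 →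
              resOfLe (geomTorsion (W.baseChange K) ((p : ℤ) ^ 1))
                ((Subgroup.zpowers_le.mpr hφ).trans (κ.kerSubgroup_le_layerSubgroup 0)) (z.1 0 1) = 0) →
      ∀ [Module (ZMod p) (AdditiveKoly.Vp W K p)],
        3 ≤ Module.finrank (ZMod p)
          (AddSubgroup.toZModSubmodule p (WeierstrassCurve.selmerGroup (W.baseChange K) ((p ^ 1 : ℕ) : ℤ))) →
        ∃ s : Finset ℕ, IsZhangAdmissibleLevel N K (fun ℓ ↦ W.frobeniusTrace ℓ) p s ∧ Odd s.card ∧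
          ∃ (S : Brandt.XiSetup N (∏ q ∈ s, q)) (ψ : K →ₐ[ℚ] S.D) (I : Submodule ℤ S.D) (φ : Brandt.ClassSet S.O → ZMod p),
            Brandt.IsGrossPoint S.O ψ I ∧
            (letI : Fintype (Brandt.ClassSet S.O) := Fintype.ofFinite _
             φ ∈ Brandt.eigenSpace (ZMod p) (N * ∏ q ∈ s, q) (Brandt.matrix S.O) (fun ℓ ↦ W.frobeniusTrace ℓ)) ∧
            Brandt.toricPeriod S.O ψ I (fun i ↦ (Brandt.weight S.O i : ZMod p) * φ i) ≠ 0) :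
    ∀ {p : ℕ} [Fact p.Prime] (ι : PadicAlgCl p ≃+* ℂ) (W : WeierstrassCurve ℚ) [W.IsElliptic]
      [W.IsGloballyMinimal] (K : Type) [Field K] [NumberField K]
      (𝔭 𝔭bar : HeightOneSpectrum (𝓞 K)) (κ : ZpExtension K p) (γ : absoluteGaloisGroup K)
      [hγF : Fact (κ.IsTopGenerator γ)] {N : ℕ} [NeZero N] {f : CuspForm (CongruenceSubgroup.Gamma0 N) 2}
      (_ : IsNewformOf W f),
      (N : ℤ) = W.conductorNorm ℤ → 5 ≤ p → W.HasGoodReductionAtPrime p → W.frobeniusTrace p = 0 →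
      Surj W p →
      IsImaginaryQuadratic K → ((Ideal.span {(p : ℤ)}).primesOver (𝓞 K)).ncard = 2 →
        (h𝔭 : ((p : ℕ) : 𝓞 K) ∈ 𝔭.asIdeal) →
        (∀ (w : InfinitePlace K) (k : 𝓞 K), k ∈ 𝔭.asIdeal ↔ ‖ι.symm (w.embedding (k : K))‖ < 1) →
        ((p : ℕ) : 𝓞 K) ∈ 𝔭bar.asIdeal → (hne : 𝔭bar ≠ 𝔭) →
      (∀ ℓ : ℕ, ℓ.Prime → ℓ ∣ N → ((Ideal.span {(ℓ : ℤ)}).primesOver (𝓞 K)).ncard = 2) →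
      IsCoprime (N : ℤ) (NumberField.discr K) → ¬ p ∣ NumberField.classNumber K →
      ¬ Squarefree N →
      (∀ q : ℕ, q.Prime → q ∣ N →
        ∃ v : HeightOneSpectrum (𝓞 ℚ), ((q : ℕ) : 𝓞 ℚ) ∈ v.asIdeal ∧
          ∃ 𝔓 ∈ v.primesAbove, ∃ σ ∈ 𝔓.inertia (absoluteGaloisGroup ℚ),
            ∃ P : W.geomTorsion (p : ℤ), σ • P ≠ P) →
      κ.IsAnticyclotomic →
      ∀ (h𝔭ns : AcSigned.IsNonsplitIn κ 𝔭) (γ𝔭 : absoluteGaloisGroup (𝔭.adicCompletion K))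
        (hγ𝔭 : κ (resGalOfEmb (closureEmb (K := K) (𝔭.adicCompletion K)) γ𝔭) = κ γ),
        ∃ (ΩK : ℂ) (Ωp : (unrIntegers p)ˣ) (L : UnrSeries p), ΩK ≠ 0 ∧
          IsCWBDPLFunction ι 𝔭 κ γ f (NumberField.discr K) ΩK ((Ωp : unrIntegers p) : ℂ_[p]) L ∧
          ∃ (z : AcSigned.selmerLambdaAdic (W.baseChange K) p κ γ (fun _ ↦ .sgn 1))
            (B : CastellaHsuKunduLeeLiu2025.SignedBipartiteSystem W K p κ),
            AcSigned.TransferInputs (W.baseChange K) p κ γ hγF.out 𝔭 h𝔭ns γ𝔭 hγ𝔭 𝔭bar (fun h ↦ hne h.symm) h𝔭 1 z L ∧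
            CastellaHsuKunduLeeLiu2025.IsSignedBipartiteSystem W K p κ γ N 1 B ∧ B.IsLimitBaseClass z.1 ∧ B.HasUnitLambda N := by
  intro p _ ι W _ _ K _ _ 𝔭 𝔭bar κ γ hγF N _ f hf hN hp hgood hap hsurj hK hsplit h𝔭 hι h𝔭bar hne hHeeg hcop hh hnsq hram hac
    h𝔭ns γ𝔭 hγ𝔭
  obtain ⟨ΩK, Ωp, L, hΩ, hBDP, z, B, hTz, hB, hbase, hbridge⟩ :=
    hBr ι W K 𝔭 𝔭bar κ γ hf hN hp hgood hap hsurj hK hsplit h𝔭 hι h𝔭bar hne hHeeg hcop hh hnsq hram hac h𝔭ns γ𝔭 hγ𝔭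
  refine ⟨ΩK, Ωp, L, hΩ, hBDP, z, B, hTz, hB, hbase, ?_⟩
  refine SignedBaseChangeAcDivAdmdefRootDichotomy.hasUnitLambda_of_rootDichotomy hB hbase
    (fun m ↦ ∃ (S : Brandt.XiSetup N m) (ψ : K →ₐ[ℚ] S.D) (I : Submodule ℤ S.D) (φ : Brandt.ClassSet S.O → ZMod p),
      Brandt.IsGrossPoint S.O ψ I ∧
      (letI : Fintype (Brandt.ClassSet S.O) := Fintype.ofFinite _
       φ ∈ Brandt.eigenSpace (ZMod p) (N * m) (Brandt.matrix S.O) (fun ℓ ↦ W.frobeniusTrace ℓ)) ∧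
      Brandt.toricPeriod S.O ψ I (fun i ↦ (Brandt.weight S.O i : ZMod p) * φ i) ≠ 0)
    hbridge fun hinv ↦ ?_
  -- NON-primitive root: the tuple at hand witnesses (NP)
  have hNP : (∃ (ι : PadicAlgCl p ≃+* ℂ) (𝔭 𝔭bar : HeightOneSpectrum (𝓞 K)) (κ : ZpExtension K p) (γ : absoluteGaloisGroup K)
      (hγ : κ.IsTopGenerator γ) (h𝔭 : ((p : ℕ) : 𝓞 K) ∈ 𝔭.asIdeal) (hne : 𝔭bar ≠ 𝔭)
      (h𝔭ns : AcSigned.IsNonsplitIn κ 𝔭) (γ𝔭 : absoluteGaloisGroup (𝔭.adicCompletion K))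
      (hγ𝔭 : κ (resGalOfEmb (closureEmb (K := K) (𝔭.adicCompletion K)) γ𝔭) = κ γ)
      (ΩK : ℂ) (Ωp : (unrIntegers p)ˣ) (L : UnrSeries p)
      (z : AcSigned.selmerLambdaAdic (W.baseChange K) p κ γ (fun _ ↦ .sgn 1))
      (B : CastellaHsuKunduLeeLiu2025.SignedBipartiteSystem W K p κ),
      κ.IsAnticyclotomic ∧ (∀ (w : InfinitePlace K) (k : 𝓞 K), k ∈ 𝔭.asIdeal ↔ ‖ι.symm (w.embedding (k : K))‖ < 1) ∧
      ((p : ℕ) : 𝓞 K) ∈ 𝔭bar.asIdeal ∧ ΩK ≠ 0 ∧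
      IsCWBDPLFunction ι 𝔭 κ γ f (NumberField.discr K) ΩK ((Ωp : unrIntegers p) : ℂ_[p]) L ∧
      AcSigned.TransferInputs (W.baseChange K) p κ γ hγ 𝔭 h𝔭ns γ𝔭 hγ𝔭 𝔭bar (fun h ↦ hne h.symm) h𝔭 1 z L ∧
      CastellaHsuKunduLeeLiu2025.IsSignedBipartiteSystem W K p κ γ N 1 B ∧ B.IsLimitBaseClass z.1 ∧
      ∀ (q : ℕ), IsAdmissiblePrime N K (fun ℓ ↦ W.frobeniusTrace ℓ) p 1 q →
        ∀ (v : HeightOneSpectrum (𝓞 K)), ((q : ℕ) : 𝓞 K) ∈ v.asIdeal →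
        ∀ 𝔓 ∈ v.primesAbove, ∀ (φ : absoluteGaloisGroup K) (hφ : φ ∈ κ.kerSubgroup),
          φ ∈ 𝔓.decompositionSubgroup (absoluteGaloisGroup K) → IsArithFrobAt (𝓞 K) φ 𝔓 →
          resOfLe (geomTorsion (W.baseChange K) ((p : ℤ) ^ 1))
            ((Subgroup.zpowers_le.mpr hφ).trans (κ.kerSubgroup_le_layerSubgroup 0)) (z.1 0 1) = 0) :=
    ⟨ι, 𝔭, 𝔭bar, κ, γ, hγF.out, h𝔭, hne, h𝔭ns, γ𝔭, hγ𝔭, ΩK, Ωp, L, z, B, hac, hι, h𝔭bar, hΩ, hBDP, hTz, hB, hbase, hinv⟩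
  obtain ⟨c, hc1⟩ := AdditiveKoly.exists_algEquiv_ne_one_of_isImaginaryQuadratic K hK
  letI : Module (ZMod p) (AdditiveKoly.Vp W K p) :=
    AddCommGroup.zmodModule (SignedBaseChangeAcDivOfStubsAdmdefV8.p_nsmul_vp_eq_zero' W K)
  have hp2 : p ≠ 2 := by omega
  have hpar := SignedBaseChangeAcDivAdmdefOddSelmerDim.oddSelmerDim_of_casselsTate_of_dokchitser hCT hDD W K hN hp hsurj hK hHeeg c hc1
  have hdim := AdditiveKoly.finrank_selmer_eq_finrank_selQP_add W K p hp2 hK c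
    (SignedBaseChangeAcDivAdmdefOddSelmerDim.algEquiv_mul_self_eq_one_of_ne_one hK.1 hc1)
  -- the SELMER-RANK SPLIT on the parity witness: `d = 2k + 1`
  obtain ⟨k, hk⟩ := hpar
  rcases Nat.eq_zero_or_pos k with hk0 | hk0
  · -- the core root `d = 1`: the piece is EMPTY by (RV₁)
    subst hk0
    exact absurd hNP (hRV W K hf hN hp hgood hap hsurj hK hsplit hHeeg hcop hh hnsq hram (hdim.trans (hk.trans (by omega))))
  · -- off the core root: `d ≥ 3`; the EXISTENTIAL anchor is the walk hypothesis itself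
    have h3 := le_of_le_of_eq (show 3 ≤ 2 * k + 1 by omega) (hdim.trans hk).symm
    exact hAnchE W K hf hN hp hgood hap hsurj hK hsplit hHeeg hcop hh hnsq hram hNP h3

/-! ## §2 Conservativity: the vertex-wise anchor (v18) implies the existential one (v19) -/

/-- **Conservativity certificate of the v19 reshape**: v18's vertex-wise text (Anch±)_NP,≥3 (unit weighted period at EVERY odd zero vertex carrying both
Bertolini–Darmon signs, on (NP) with `3 ≤ dim_𝔽p Sel_p(E/K)[p]`) implies the v19 EXISTENTIAL text (Anch∃)_NP,≥3, by W. Zhang's walk + the signed detour on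
cell β (`…OfStubsAdmdefV14.exists_admissibleOddLevel_of_anchorSigned_of_split`) fed by (Par) (Cassels–Tate + Dokchitser–Dokchitser via `…AdmdefOddSelmerDim`)
and complex conjugation `c ≠ 1`.  ONE WAY only in kernel: the converse is the length-one rigidity reading (BCK21 Prop. 7.4: unit at some core odd vertex ⟺
at every one), untyped.  Orphan by design (a certificate, not a composition edge). [cite: WZhang2014, Thm. 9.1 (proof), Lemma 7.3, §9 (9.2)]
[cite: DokchitserDokchitserAnnals2010, §4.6] [cite: BurungaleCastellaKim2021, arXiv:1908.09512 Prop. 7.4] -/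
theorem anchorExists3_of_anchorNP3
    (hCT : ∀ (K : Type) [Field K] [NumberField K], WeierstrassCurve.exists_casselsTate_pairing (K := K))
    (hDD : Literature.NumberTheory.EllipticCurves.dokchitser_selmerCorank_baseChange_mod_two_eq)
    (hAnch3 :
    ∀ {p : ℕ} [Fact p.Prime] (W : WeierstrassCurve ℚ) [W.IsElliptic] [W.IsGloballyMinimal]
      (K : Type) [Field K] [NumberField K] {N : ℕ} [NeZero N] {f : CuspForm (CongruenceSubgroup.Gamma0 N) 2}
      (_ : IsNewformOf W f),
      (N : ℤ) = W.conductorNorm ℤ → 5 ≤ p → W.HasGoodReductionAtPrime p → W.frobeniusTrace p = 0 →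
      Surj W p →
      IsImaginaryQuadratic K → ((Ideal.span {(p : ℤ)}).primesOver (𝓞 K)).ncard = 2 →
      (∀ ℓ : ℕ, ℓ.Prime → ℓ ∣ N → ((Ideal.span {(ℓ : ℤ)}).primesOver (𝓞 K)).ncard = 2) →
      IsCoprime (N : ℤ) (NumberField.discr K) → ¬ p ∣ NumberField.classNumber K →
      ¬ Squarefree N →
      (∀ q : ℕ, q.Prime → q ∣ N →
        ∃ v : HeightOneSpectrum (𝓞 ℚ), ((q : ℕ) : 𝓞 ℚ) ∈ v.asIdeal ∧
          ∃ 𝔓 ∈ v.primesAbove, ∃ σ ∈ 𝔓.inertia (absoluteGaloisGroup ℚ),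
            ∃ P : W.geomTorsion (p : ℤ), σ • P ≠ P) →
      -- (NP) [v16]: some PINNED `+` tuple whose bottom class is invisible at every admissible Frobenius
      (∃ (ι : PadicAlgCl p ≃+* ℂ) (𝔭 𝔭bar : HeightOneSpectrum (𝓞 K)) (κ : ZpExtension K p) (γ : absoluteGaloisGroup K)
          (hγ : κ.IsTopGenerator γ) (h𝔭 : ((p : ℕ) : 𝓞 K) ∈ 𝔭.asIdeal) (hne : 𝔭bar ≠ 𝔭)
          (h𝔭ns : AcSigned.IsNonsplitIn κ 𝔭) (γ𝔭 : absoluteGaloisGroup (𝔭.adicCompletion K))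
          (hγ𝔭 : κ (resGalOfEmb (closureEmb (K := K) (𝔭.adicCompletion K)) γ𝔭) = κ γ)
          (ΩK : ℂ) (Ωp : (unrIntegers p)ˣ) (L : UnrSeries p)
          (z : AcSigned.selmerLambdaAdic (W.baseChange K) p κ γ (fun _ ↦ .sgn 1))
          (B : CastellaHsuKunduLeeLiu2025.SignedBipartiteSystem W K p κ),
          κ.IsAnticyclotomic ∧ (∀ (w : InfinitePlace K) (k : 𝓞 K), k ∈ 𝔭.asIdeal ↔ ‖ι.symm (w.embedding (k : K))‖ < 1) ∧
          ((p : ℕ) : 𝓞 K) ∈ 𝔭bar.asIdeal ∧ ΩK ≠ 0 ∧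
          IsCWBDPLFunction ι 𝔭 κ γ f (NumberField.discr K) ΩK ((Ωp : unrIntegers p) : ℂ_[p]) L ∧
          AcSigned.TransferInputs (W.baseChange K) p κ γ hγ 𝔭 h𝔭ns γ𝔭 hγ𝔭 𝔭bar (fun h ↦ hne h.symm) h𝔭 1 z L ∧
          CastellaHsuKunduLeeLiu2025.IsSignedBipartiteSystem W K p κ γ N 1 B ∧ B.IsLimitBaseClass z.1 ∧
          ∀ (q : ℕ), IsAdmissiblePrime N K (fun ℓ ↦ W.frobeniusTrace ℓ) p 1 q →
            ∀ (v : HeightOneSpectrum (𝓞 K)), ((q : ℕ) : 𝓞 K) ∈ v.asIdeal →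
            ∀ 𝔓 ∈ v.primesAbove, ∀ (φ : absoluteGaloisGroup K) (hφ : φ ∈ κ.kerSubgroup),
              φ ∈ 𝔓.decompositionSubgroup (absoluteGaloisGroup K) → IsArithFrobAt (𝓞 K) φ 𝔓 →
              resOfLe (geomTorsion (W.baseChange K) ((p : ℤ) ^ 1))
                ((Subgroup.zpowers_le.mpr hφ).trans (κ.kerSubgroup_le_layerSubgroup 0)) (z.1 0 1) = 0) →
      ∀ (c : K ≃ₐ[ℚ] K), c ≠ 1 → ∀ [Module (ZMod p) (AdditiveKoly.Vp W K p)],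
        3 ≤ Module.finrank (ZMod p)
          (AddSubgroup.toZModSubmodule p (WeierstrassCurve.selmerGroup (W.baseChange K) ((p ^ 1 : ℕ) : ℤ))) →
        ∀ n : Finset (AdditiveKoly.AdmQ W K p), Odd n.card →
          (∀ s : Bool, ∃ q ∈ n, ∀ v : HeightOneSpectrum (𝓞 K), ((q : ℕ) : 𝓞 K) ∈ v.asIdeal → ∀ z : AdditiveKoly.Vp W K p,
            (W.baseChange K).torsionLocMap (v.adicCompletion K) ((p ^ 1 : ℕ) : ℤ) (conjAct W c ((p ^ 1 : ℕ) : ℤ) z) =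
              AdditiveKoly.sgnP s • (W.baseChange K).torsionLocMap (v.adicCompletion K) ((p ^ 1 : ℕ) : ℤ) z) →
          (∀ μ : Bool, AdditiveKoly.SelQP W K p c n μ = ⊥) →
          ∃ (S : Brandt.XiSetup N (∏ q ∈ n.image Subtype.val, q)) (ψ : K →ₐ[ℚ] S.D) (I : Submodule ℤ S.D)
            (φ : Brandt.ClassSet S.O → ZMod p),
            Brandt.IsGrossPoint S.O ψ I ∧
            (letI : Fintype (Brandt.ClassSet S.O) := Fintype.ofFinite _
             φ ∈ Brandt.eigenSpace (ZMod p) (N * ∏ q ∈ n.image Subtype.val, q) (Brandt.matrix S.O) (fun ℓ ↦ W.frobeniusTrace ℓ)) ∧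
            Brandt.toricPeriod S.O ψ I (fun i ↦ (Brandt.weight S.O i : ZMod p) * φ i) ≠ 0) :
    ∀ {p : ℕ} [Fact p.Prime] (W : WeierstrassCurve ℚ) [W.IsElliptic] [W.IsGloballyMinimal]
      (K : Type) [Field K] [NumberField K] {N : ℕ} [NeZero N] {f : CuspForm (CongruenceSubgroup.Gamma0 N) 2}
      (_ : IsNewformOf W f),
      (N : ℤ) = W.conductorNorm ℤ → 5 ≤ p → W.HasGoodReductionAtPrime p → W.frobeniusTrace p = 0 →
      Surj W p →
      IsImaginaryQuadratic K → ((Ideal.span {(p : ℤ)}).primesOver (𝓞 K)).ncard = 2 →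
      (∀ ℓ : ℕ, ℓ.Prime → ℓ ∣ N → ((Ideal.span {(ℓ : ℤ)}).primesOver (𝓞 K)).ncard = 2) →
      IsCoprime (N : ℤ) (NumberField.discr K) → ¬ p ∣ NumberField.classNumber K →
      ¬ Squarefree N →
      (∀ q : ℕ, q.Prime → q ∣ N →
        ∃ v : HeightOneSpectrum (𝓞 ℚ), ((q : ℕ) : 𝓞 ℚ) ∈ v.asIdeal ∧
          ∃ 𝔓 ∈ v.primesAbove, ∃ σ ∈ 𝔓.inertia (absoluteGaloisGroup ℚ),
            ∃ P : W.geomTorsion (p : ℤ), σ • P ≠ P) →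
      -- (NP): some PINNED `+` tuple whose bottom class is invisible at every admissible Frobenius
      (∃ (ι : PadicAlgCl p ≃+* ℂ) (𝔭 𝔭bar : HeightOneSpectrum (𝓞 K)) (κ : ZpExtension K p) (γ : absoluteGaloisGroup K)
          (hγ : κ.IsTopGenerator γ) (h𝔭 : ((p : ℕ) : 𝓞 K) ∈ 𝔭.asIdeal) (hne : 𝔭bar ≠ 𝔭)
          (h𝔭ns : AcSigned.IsNonsplitIn κ 𝔭) (γ𝔭 : absoluteGaloisGroup (𝔭.adicCompletion K))
          (hγ𝔭 : κ (resGalOfEmb (closureEmb (K := K) (𝔭.adicCompletion K)) γ𝔭) = κ γ)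
          (ΩK : ℂ) (Ωp : (unrIntegers p)ˣ) (L : UnrSeries p)
          (z : AcSigned.selmerLambdaAdic (W.baseChange K) p κ γ (fun _ ↦ .sgn 1))
          (B : CastellaHsuKunduLeeLiu2025.SignedBipartiteSystem W K p κ),
          κ.IsAnticyclotomic ∧ (∀ (w : InfinitePlace K) (k : 𝓞 K), k ∈ 𝔭.asIdeal ↔ ‖ι.symm (w.embedding (k : K))‖ < 1) ∧
          ((p : ℕ) : 𝓞 K) ∈ 𝔭bar.asIdeal ∧ ΩK ≠ 0 ∧
          IsCWBDPLFunction ι 𝔭 κ γ f (NumberField.discr K) ΩK ((Ωp : unrIntegers p) : ℂ_[p]) L ∧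
          AcSigned.TransferInputs (W.baseChange K) p κ γ hγ 𝔭 h𝔭ns γ𝔭 hγ𝔭 𝔭bar (fun h ↦ hne h.symm) h𝔭 1 z L ∧
          CastellaHsuKunduLeeLiu2025.IsSignedBipartiteSystem W K p κ γ N 1 B ∧ B.IsLimitBaseClass z.1 ∧
          ∀ (q : ℕ), IsAdmissiblePrime N K (fun ℓ ↦ W.frobeniusTrace ℓ) p 1 q →
            ∀ (v : HeightOneSpectrum (𝓞 K)), ((q : ℕ) : 𝓞 K) ∈ v.asIdeal →
            ∀ 𝔓 ∈ v.primesAbove, ∀ (φ : absoluteGaloisGroup K) (hφ : φ ∈ κ.kerSubgroup),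
              φ ∈ 𝔓.decompositionSubgroup (absoluteGaloisGroup K) → IsArithFrobAt (𝓞 K) φ 𝔓 →
              resOfLe (geomTorsion (W.baseChange K) ((p : ℤ) ^ 1))
                ((Subgroup.zpowers_le.mpr hφ).trans (κ.kerSubgroup_le_layerSubgroup 0)) (z.1 0 1) = 0) →
      ∀ [Module (ZMod p) (AdditiveKoly.Vp W K p)],
        3 ≤ Module.finrank (ZMod p)
          (AddSubgroup.toZModSubmodule p (WeierstrassCurve.selmerGroup (W.baseChange K) ((p ^ 1 : ℕ) : ℤ))) →
        ∃ s : Finset ℕ, IsZhangAdmissibleLevel N K (fun ℓ ↦ W.frobeniusTrace ℓ) p s ∧ Odd s.card ∧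
          ∃ (S : Brandt.XiSetup N (∏ q ∈ s, q)) (ψ : K →ₐ[ℚ] S.D) (I : Submodule ℤ S.D) (φ : Brandt.ClassSet S.O → ZMod p),
            Brandt.IsGrossPoint S.O ψ I ∧
            (letI : Fintype (Brandt.ClassSet S.O) := Fintype.ofFinite _
             φ ∈ Brandt.eigenSpace (ZMod p) (N * ∏ q ∈ s, q) (Brandt.matrix S.O) (fun ℓ ↦ W.frobeniusTrace ℓ)) ∧
            Brandt.toricPeriod S.O ψ I (fun i ↦ (Brandt.weight S.O i : ZMod p) * φ i) ≠ 0 := by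
  intro p _ W _ _ K _ _ N _ f hf hN hp hgood hap hsurj hK hsplit hHeeg hcop hh hnsq hram hNP _ h3
  obtain ⟨c, hc1⟩ := AdditiveKoly.exists_algEquiv_ne_one_of_isImaginaryQuadratic K hK
  exact SignedBaseChangeAcDivOfStubsAdmdefV14.exists_admissibleOddLevel_of_anchorSigned_of_split W K hN hp hsurj hK hHeeg
    hsplit hc1
    (SignedBaseChangeAcDivAdmdefOddSelmerDim.oddSelmerDim_of_casselsTate_of_dokchitser hCT hDD W K hN hp hsurj hK hHeeg c hc1)
    (fun m ↦ ∃ (S : Brandt.XiSetup N m) (ψ : K →ₐ[ℚ] S.D) (I : Submodule ℤ S.D) (φ : Brandt.ClassSet S.O → ZMod p),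
      Brandt.IsGrossPoint S.O ψ I ∧
      (letI : Fintype (Brandt.ClassSet S.O) := Fintype.ofFinite _
       φ ∈ Brandt.eigenSpace (ZMod p) (N * m) (Brandt.matrix S.O) (fun ℓ ↦ W.frobeniusTrace ℓ)) ∧
      Brandt.toricPeriod S.O ψ I (fun i ↦ (Brandt.weight S.O i : ZMod p) * φ i) ≠ 0)
    (hAnch3 W K hf hN hp hgood hap hsurj hK hsplit hHeeg hcop hh hnsq hram hNP c hc1 h3)

end Summit.BirchSwinnertonDyer.BirchSwinnertonDyer.Theorems.SignedBaseChangeAcDivAdmdefRankSplit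

end
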